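import Summits.SmoothPoincare4.SmoothPoincare4.Theorems.EntropyRungChangGurskyYangStubSmoothRoundLimitAux3
import HarnessLib

/-!
# The scaled Ricci flow read in a chart, II: convergence, covariant Ricci components, velocity
(helper file 4 for stub `stub_smoothRoundLimit`, line `margerin-cone-hamilton-rails`, crux
`EntropyRung.ChangGurskyYang`, item stmt-SmoothPoincare4-10834)

Sequel of helper file 3 (general model, chart at `z`, closed ball `B̄(ẑ, r) ⊆ target`):

* `scaledChartRep_tendsto_of_envelope` — the scaled representatives `G_t(y)/(T−t)` converge in
  operator norm, uniformly on the ball at the rate `a(t)`, to symmetric uniformly positive forms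
  (polarisation and completeness of the space of forms; Hamilton 1982, Lemma 14.2);
* `abs_tcovIter_ric2_le_of_scaledShi` — the components of all `∇ᵏRic` in the chart are bounded
  on `B̄(ẑ, r) × [t₀, T)` (`|∇ᵏRic|² ≤ n|∇ᵏRm|²`, components against the invariant norm with
  `‖G‖ ≤ C₀ (T−t)`, and the scaled Shi bounds: the powers of `T − t` cancel);
* `abs_chartRep_sub_two_mul_ricAt_le` — `|G_t(y)(v,w) − 2(T−t) Ric(G_t)(y)(v,w)| ≤
  C (T−t)^{1+δ} |v| |w|` from `|g − 2(T−t)Ric|²_g ≤ K (T−t)^{2δ}` (Hamilton 1982, Thm. 17.6).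

## References

* R. S. Hamilton, *Three-manifolds with positive Ricci curvature*, J. Differential Geom. 17
  (1982) 255–306, §14, Lemma 14.2; §17, Thm. 17.6. [Hamilton1982]
* P. Topping, *Lectures on the Ricci flow*, LMS Lecture Note Series 325, CUP 2006, §5.3,
  proof of Thm. 5.3.1, p. 47; Thm. 3.3.1. [Topping2006]
* A. L. Besse, *Einstein manifolds*, Springer 1987, 1.118. [Besse1987]
-/

noncomputable section

-- every `Summit.SmoothPoincare4.SmoothPoincare4.…` name repeats the summit = sub-problem segment (D-0017 layout)
set_option linter.dupNamespace false

-- operator spaces of bilinear forms over the model space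
set_option maxSynthPendingDepth 3

open Set Function Filter Real Module Metric
open scoped Manifold ContDiff Topology

namespace Summit.SmoothPoincare4.SmoothPoincare4.Theorems.MargerinRails

open Literature.Geometry.Riemannian
open Literature.Geometry.Lorentzian Literature.Geometry.Lorentzian.PseudoRiemannianMetric
open Literature.Geometry.Lorentzian.MetricCoord

universe u v w

/-! ### General model (continued) -/

section General

variable {E : Type u} [NormedAddCommGroup E] [NormedSpace ℝ E] [FiniteDimensional ℝ E]
  [CompleteSpace E] {H : Type v} [TopologicalSpace H] {I : ModelWithCorners ℝ E H} [I.Boundaryless]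
  {M : Type w} [TopologicalSpace M] [ChartedSpace H M] [IsManifold I ∞ M]
  {g : ℝ → PseudoRiemannianMetric I ∞ E (TangentSpace I : M → Type _)}
  {cov : ℝ → CovariantDerivative I E (TangentSpace I : M → Type _)} {T t₀ : ℝ}

/-! #### Convergence of the scaled representative in operator norm -/

omit [CompleteSpace E] in
/-- **The scaled representatives converge in operator norm, uniformly on the ball**: under the
hypotheses of `scaledChartRep_twoSided_of_envelope`, if moreover every scaled diagonal entry
converges to its `ℓ` and `a(t) → 0` as `t ↑ T`, then for every `y ∈ B̄(ẑ, r)` the forms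
`G_t(y)/(T−t)` converge as `t ↑ T` to a symmetric form `L(y)` with `λ|v|² ≤ L(y)(v,v)` and
`‖G_t(y)/(T−t) − L(y)‖ ≤ C₁ a(t)` on `[t₀, T)` (polarisation, `norm_le_of_quadratic_le`, and the
completeness of the finite-dimensional space of forms). [cite: Hamilton1982, §14, Lemma 14.2] -/
theorem scaledChartRep_tendsto_of_envelope (hsm : IsContMDiffFamilyOn ∞ g (Ico 0 T))
    (hR : ∀ t ∈ Ico 0 T, (g t).IsRiemannian) (ht₀ : t₀ ∈ Ico 0 T) {a : ℝ → ℝ}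
    (ha : ∀ t ∈ Ico t₀ T, 0 ≤ a t ∧ a t ≤ a t₀) (ha0 : Tendsto a (𝓝[<] T) (𝓝 0))
    (z : M) {r : ℝ} (hr : 0 ≤ r)
    (hcl : closedBall (extChartAt I z z) r ⊆ (extChartAt I z).target)
    (henv : ∀ y ∈ closedBall (extChartAt I z z) r, ∀ v : E, ∃ ℓ : ℝ,
      Tendsto (fun s ↦ chartRep I g z s y v v / (T - s)) (𝓝[<] T) (𝓝 ℓ) ∧ ∀ t ∈ Ico t₀ T,
      exp (-a t) * (chartRep I g z t y v v / (T - t)) ≤ ℓ ∧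
        ℓ ≤ exp (a t) * (chartRep I g z t y v v / (T - t))) :
    ∃ lam > (0 : ℝ), ∃ C₀ : ℝ, ∃ L : E → E →L[ℝ] E →L[ℝ] ℝ,
      ∀ y ∈ closedBall (extChartAt I z z) r,
      Tendsto (fun t ↦ (T - t)⁻¹ • chartRep I g z t y) (𝓝[<] T) (𝓝 (L y)) ∧
      (∀ v w, L y v w = L y w v) ∧ (∀ v, lam * ‖v‖ ^ 2 ≤ L y v v) ∧
      ∀ t ∈ Ico t₀ T, (∀ v, lam * (T - t) * ‖v‖ ^ 2 ≤ chartRep I g z t y v v) ∧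
        ‖chartRep I g z t y‖ ≤ C₀ * (T - t) ∧
        ‖(T - t)⁻¹ • chartRep I g z t y - L y‖ ≤ C₀ * a t := by
  obtain ⟨lam, hlam, C₀, hb⟩ := scaledChartRep_twoSided_of_envelope hsm hR ht₀ ha z hr hcl
    (fun y hy v ↦ (henv y hy v).imp fun ℓ h ↦ h.2)
  have hT : t₀ < T := ht₀.2
  have hC₀ : 0 ≤ C₀ := by
    have h := (hb t₀ ⟨le_rfl, hT⟩ _ (mem_closedBall_self hr)).2.1
    exact nonneg_of_mul_nonneg_left ((norm_nonneg _).trans h) (sub_pos.2 hT)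
  -- the scaled family and its Cauchy estimate
  set F : E → ℝ → E →L[ℝ] E →L[ℝ] ℝ := fun y t ↦ (T - t)⁻¹ • chartRep I g z t y with hF
  have hFapp : ∀ y t v w, F y t v w = chartRep I g z t y v w / (T - t) := fun y t v w ↦ by
    simp only [hF, FunLike.coe_smul, Pi.smul_apply, smul_eq_mul, div_eq_inv_mul]
  have hcauchy : ∀ y ∈ closedBall (extChartAt I z z) r, ∀ t ∈ Ico t₀ T, ∀ s ∈ Ico t₀ T,
      ‖F y t - F y s‖ ≤ 2 * (C₀ * (a t + a s)) := by
    intro y hy t ht s hs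
    have hsymm : ∀ v w, (F y t - F y s) v w = (F y t - F y s) w v := fun v w ↦ by
      simp only [_root_.sub_apply, hFapp, chartRep_symm z t (hcl hy) v w, chartRep_symm z s (hcl hy) v w]
    refine norm_le_of_quadratic_le hsymm (mul_nonneg hC₀ (add_nonneg (ha t ht).1 (ha s hs).1))
      fun v ↦ ?_
    obtain ⟨ℓ, -, hℓ⟩ := henv y hy v
    have h1 := (hb t ht y hy).2.2 v ℓ hℓ
    have h2 := (hb s hs y hy).2.2 v ℓ hℓ
    simp only [_root_.sub_apply, hFapp]
    calc |chartRep I g z t y v v / (T - t) - chartRep I g z s y v v / (T - s)|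
        ≤ |chartRep I g z t y v v / (T - t) - ℓ| + |chartRep I g z s y v v / (T - s) - ℓ| := by
          rw [← abs_sub_comm ℓ (chartRep I g z s y v v / (T - s))]
          exact abs_sub_le _ _ _
      _ ≤ C₀ * a t * ‖v‖ ^ 2 + C₀ * a s * ‖v‖ ^ 2 := add_le_add h1 h2
      _ = C₀ * (a t + a s) * ‖v‖ ^ 2 := by ring
  -- hence convergence (completeness)
  haveI : (𝓝[<] T).NeBot := nhdsLT_neBot T
  have hconv : ∀ y ∈ closedBall (extChartAt I z z) r, ∃ Ly, Tendsto (F y) (𝓝[<] T) (𝓝 Ly) := by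
    intro y hy
    refine cauchy_map_iff_exists_tendsto.1 ?_
    rw [Metric.cauchy_iff]
    refine ⟨Filter.map_neBot, fun ε hε ↦ ?_⟩
    -- `a < ε/(4 C₀ + 4)` eventually
    have hε' : 0 < ε / (4 * C₀ + 4) := div_pos hε (by linarith)
    have hev : ∀ᶠ t in 𝓝[<] T, |a t| < ε / (4 * C₀ + 4) := by
      have := (Metric.tendsto_nhds.1 ha0) _ hε'
      simpa [Real.dist_eq] using this
    have hev' : ∀ᶠ t in 𝓝[<] T, t ∈ Ico t₀ T := Ico_mem_nhdsLT hT
    obtain ⟨S, hS, hSsub⟩ := (hev.and hev').exists_mem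
    refine ⟨F y '' S, image_mem_map hS, ?_⟩
    rintro _ ⟨t, htS, rfl⟩ _ ⟨s, hsS, rfl⟩
    obtain ⟨hta, ht⟩ := hSsub t htS
    obtain ⟨hsa, hs⟩ := hSsub s hsS
    rw [dist_eq_norm]
    have h := hcauchy y hy t ht s hs
    have hat : a t < ε / (4 * C₀ + 4) := (le_abs_self _).trans_lt hta
    have has : a s < ε / (4 * C₀ + 4) := (le_abs_self _).trans_lt hsa
    have hsum : a t + a s ≤ ε / (4 * C₀ + 4) + ε / (4 * C₀ + 4) := by linarith
    calc ‖F y t - F y s‖ ≤ 2 * (C₀ * (a t + a s)) := h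
      _ ≤ 2 * (C₀ * (ε / (4 * C₀ + 4) + ε / (4 * C₀ + 4))) := by gcongr
      _ = ε * (C₀ / (C₀ + 1)) := by field_simp; ring
      _ < ε := by
          have : C₀ / (C₀ + 1) < 1 := (div_lt_one (by linarith)).2 (by linarith)
          nlinarith
  -- the limit forms
  set L : E → E →L[ℝ] E →L[ℝ] ℝ := fun y ↦ limUnder (𝓝[<] T) (F y) with hL
  have hLt : ∀ y ∈ closedBall (extChartAt I z z) r, Tendsto (F y) (𝓝[<] T) (𝓝 (L y)) :=
    fun y hy ↦ tendsto_nhds_limUnder (hconv y hy)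
  have hev : ∀ᶠ t in 𝓝[<] T, t ∈ Ico t₀ T := Ico_mem_nhdsLT hT
  refine ⟨lam, hlam, max C₀ (2 * C₀), L, fun y hy ↦ ⟨hLt y hy, fun v w ↦ ?_, fun v ↦ ?_,
    fun t ht ↦ ⟨(hb t ht y hy).1, (hb t ht y hy).2.1.trans
      (mul_le_mul_of_nonneg_right (le_max_left _ _) (sub_pos.2 ht.2).le), ?_⟩⟩⟩
  · -- symmetry
    have h1 := tendsto_apply₂_of_tendsto (hLt y hy) v w
    have h2 := tendsto_apply₂_of_tendsto (hLt y hy) w v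
    have heq : (fun t ↦ F y t v w) = fun t ↦ F y t w v := funext fun t ↦ by
      rw [hFapp, hFapp, chartRep_symm z t (hcl hy) v w]
    rw [heq] at h1
    exact tendsto_nhds_unique h1 h2
  · -- lower bound in the limit
    have h1 := tendsto_apply₂_of_tendsto (hLt y hy) v v
    refine ge_of_tendsto h1 (hev.mono fun t ht ↦ ?_)
    rw [hFapp, le_div_iff₀ (sub_pos.2 ht.2)]
    calc lam * ‖v‖ ^ 2 * (T - t) = lam * (T - t) * ‖v‖ ^ 2 := by ring
      _ ≤ chartRep I g z t y v v := (hb t ht y hy).1 v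
  · -- the rate: pass to the limit `s ↑ T` in the Cauchy estimate
    have h1 : Tendsto (fun s ↦ ‖F y t - F y s‖) (𝓝[<] T) (𝓝 ‖F y t - L y‖) :=
      (tendsto_const_nhds.sub (hLt y hy)).norm
    have h2 : Tendsto (fun s ↦ 2 * (C₀ * (a t + a s))) (𝓝[<] T) (𝓝 (2 * (C₀ * (a t + 0)))) :=
      ((tendsto_const_nhds.add ha0).const_mul C₀).const_mul 2
    have h3 := le_of_tendsto_of_tendsto h1 h2 (hev.mono fun s hs ↦ hcauchy y hy t ht s hs)
    rw [add_zero] at h3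
    calc ‖(T - t)⁻¹ • chartRep I g z t y - L y‖ = ‖F y t - L y‖ := rfl
      _ ≤ 2 * (C₀ * a t) := h3
      _ = 2 * C₀ * a t := by ring
      _ ≤ max C₀ (2 * C₀) * a t := mul_le_mul_of_nonneg_right (le_max_right _ _) (ha t ht).1

/-! #### Components of the covariant Ricci derivatives from the scaled Shi bounds -/

/-- **The components of all `∇ᵏRic` in the chart are bounded near `T` under the scaled Shi bounds
and the scaled two-sided bounds of the representative** (Topping 2006, p. 47, (5.3.3) in scaled
form): if `|∇ᵏRm|²(t, ·) ≤ C' (T−t)^{−k−2}` on `M × [t₀, T)` and `‖G_t(y)‖ ≤ C₀ (T−t)` on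
`B̄(ẑ, r) × [t₀, T)`, then `|(∇ᵏRic)_J| ≤ C` there: `|∇ᵏRic|²_g ≤ n |∇ᵏRm|²_g`
(`tnormSq_tcovIter_ric2_le`), and `μ^{k+2} (∇ᵏRic)_J² ≤ |∇ᵏRic|²_g` with
`μ = (‖G_t(y)‖ Σ|b_i|²)⁻¹ ≥ (C₀ (T−t) Σ|b_i|²)⁻¹` (`sq_le_mul_tnormSq`), the powers of `T − t`
cancelling exactly (scale invariance of the components of `∇ᵏRic`).
[cite: Topping2006, §5.3, proof of Thm. 5.3.1, (5.3.3), p. 47] [cite: Topping2006, Thm. 3.3.1] -/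
theorem abs_tcovIter_ric2_le_of_scaledShi (hR : ∀ t ∈ Ico 0 T, (g t).IsRiemannian)
    (ht₀ : t₀ ∈ Ico 0 T) (z : M) {r : ℝ}
    (hcl : closedBall (extChartAt I z z) r ⊆ (extChartAt I z).target) {C₀ : ℝ}
    (hGup : ∀ t ∈ Ico t₀ T, ∀ y ∈ closedBall (extChartAt I z z) r, ‖chartRep I g z t y‖ ≤ C₀ * (T - t))
    {lam : ℝ} (hlam : 0 < lam)
    (hGlo : ∀ t ∈ Ico t₀ T, ∀ y ∈ closedBall (extChartAt I z z) r, ∀ v : E,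
      lam * (T - t) * ‖v‖ ^ 2 ≤ chartRep I g z t y v v)
    {k : ℕ} {C' : ℝ}
    (hshi : ∀ t ∈ Ico t₀ T, ∀ x : M, curvDerivNormSq I g k t x ≤ C' * ((T - t) ^ (k + 2))⁻¹) :
    ∃ Ck : ℝ, ∀ t ∈ Ico t₀ T, ∀ y ∈ closedBall (extChartAt I z z) r, ∀ J : Fin k ⊕ Fin 2 → Fin (finrank ℝ E),
      |tcovIter (chartRep I g z t) (Module.finBasis ℝ E) k
        (ric2 (chartRep I g z t) (Module.finBasis ℝ E)) y J| ≤ Ck := by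
  classical
  set b := Module.finBasis ℝ E with hbdef
  set S : ℝ := ∑ i, ‖b i‖ ^ 2 with hS
  -- the case of a trivial model space: no index functions
  rcases isEmpty_or_nonempty (Fin (finrank ℝ E)) with hι | hι
  · exact ⟨0, fun t _ y _ J ↦ (hι.false (J (Sum.inr 0))).elim⟩
  have hSpos : 0 < S := by
    obtain ⟨i⟩ := hι
    have hi : 0 < ‖b i‖ ^ 2 := by
      have : b i ≠ 0 := b.ne_zero i
      positivity
    exact lt_of_lt_of_le hi (Finset.single_le_sum (f := fun j ↦ ‖b j‖ ^ 2)
      (fun j _ ↦ sq_nonneg _) (Finset.mem_univ i))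
  have hC₀pos : 0 < max C₀ 1 := lt_of_lt_of_le one_pos (le_max_right _ _)
  set N : ℕ := Fintype.card (Fin k ⊕ Fin 2) with hN
  have hN2 : N = k + 2 := by simp [hN]
  set n : ℝ := (Fintype.card (Fin (finrank ℝ E)) : ℝ) with hn
  -- the constant: `(T−t)^{k+2}` cancels
  refine ⟨Real.sqrt (n * max C' 0 * (max C₀ 1 * S) ^ N), fun t ht y hy J ↦ ?_⟩
  have hTt : 0 < T - t := sub_pos.2 ht.2
  have hy' : y ∈ (extChartAt I z).target := hcl hy
  have ht' : t ∈ Ico 0 T := ⟨ht₀.1.trans ht.1, ht.2⟩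
  have hGm : IsMetricOn (chartRep I g z t) (extChartAt I z).target :=
    OpensChart.isMetricOn_repr (val_chartPullback_eq_chartRep g z t)
  have hposv : ∀ v, v ≠ 0 → 0 < chartRep I g z t y v v := fun v hv ↦ chartRep_pos (hR t ht') z ⟨y, hy'⟩ v hv
  have hpos : ∀ v, 0 ≤ chartRep I g z t y v v := fun v ↦
    (mul_nonneg (mul_nonneg hlam.le hTt.le) (sq_nonneg _)).trans (hGlo t ht y hy v)
  -- Shi at the point `Φ y`, read in the chart at `z`
  have hshi' : tnormSq (chartRep I g z t) b (tcovIter (chartRep I g z t) b k (rm4 (chartRep I g z t) b)) y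
      ≤ C' * ((T - t) ^ (k + 2))⁻¹ := by
    have hsrc : (extChartAt I z).symm y ∈ (extChartAt I z).source := (extChartAt I z).map_target hy'
    have h1 := hshi t ht ((extChartAt I z).symm y)
    rw [curvDerivNormSq_eq_chart (hR t ht') hsrc k, (extChartAt I z).right_inv hy',
      curvD_eq_tcovIter, tnormSq_treindex] at h1
    exact h1
  -- `|∇ᵏRic|² ≤ n |∇ᵏRm|²`
  have hric : tnormSq (chartRep I g z t) b (tcovIter (chartRep I g z t) b k (ric2 (chartRep I g z t) b)) y
      ≤ n * (max C' 0 * ((T - t) ^ (k + 2))⁻¹) := by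
    refine (hGm.tnormSq_tcovIter_ric2_le hy' hposv k).trans ?_
    refine mul_le_mul_of_nonneg_left (hshi'.trans ?_) (Nat.cast_nonneg _)
    exact mul_le_mul_of_nonneg_right (le_max_left _ _) (inv_nonneg.2 (pow_pos hTt _).le)
  -- components against the norm
  have key := sq_le_mul_tnormSq b (hGm.isInvertible y hy') (fun v w ↦ chartRep_symm z t hy' v w)
    hpos (tcovIter (chartRep I g z t) b k (ric2 (chartRep I g z t) b)) J
  -- `μ ≥ (max C₀ 1 · S · (T−t))⁻¹`
  have hμpos : 0 < (max C₀ 1 * S * (T - t))⁻¹ := inv_pos.2 (mul_pos (mul_pos hC₀pos hSpos) hTt)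
  have hμ : (max C₀ 1 * S * (T - t))⁻¹ ≤ (‖chartRep I g z t y‖ * S)⁻¹ := by
    have hnorm : ‖chartRep I g z t y‖ * S ≤ max C₀ 1 * S * (T - t) := by
      calc ‖chartRep I g z t y‖ * S ≤ C₀ * (T - t) * S :=
            mul_le_mul_of_nonneg_right (hGup t ht y hy) hSpos.le
        _ ≤ max C₀ 1 * (T - t) * S := by gcongr; exact le_max_left _ _
        _ = max C₀ 1 * S * (T - t) := by ring
    by_cases h0 : ‖chartRep I g z t y‖ * S = 0
    · have hG0 : ‖chartRep I g z t y‖ = 0 := by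
        rcases mul_eq_zero.1 h0 with h | h
        · exact h
        · exact absurd h hSpos.ne'
      obtain ⟨i⟩ := hι
      have hbi : 0 < chartRep I g z t y (b i) (b i) := hposv (b i) (b.ne_zero i)
      have hle := abs_apply₂_le (chartRep I g z t y) (b i) (b i)
      rw [hG0, zero_mul, zero_mul] at hle
      exact absurd (lt_of_lt_of_le hbi ((le_abs_self _).trans hle)) (lt_irrefl _)
    · exact (inv_le_inv₀ (mul_pos (mul_pos hC₀pos hSpos) hTt)
        (lt_of_le_of_ne (mul_nonneg (norm_nonneg _) hSpos.le) (Ne.symm h0))).2 hnorm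
  have h1 : (max C₀ 1 * S * (T - t))⁻¹ ^ N *
      (tcovIter (chartRep I g z t) b k (ric2 (chartRep I g z t) b) y J) ^ 2 ≤
      n * (max C' 0 * ((T - t) ^ (k + 2))⁻¹) := by
    refine le_trans ?_ (key.trans hric)
    exact mul_le_mul_of_nonneg_right (pow_le_pow_left₀ hμpos.le hμ N) (sq_nonneg _)
  -- cancel the powers of `T − t`
  have h2 : (tcovIter (chartRep I g z t) b k (ric2 (chartRep I g z t) b) y J) ^ 2 ≤
      n * max C' 0 * (max C₀ 1 * S) ^ N := by
    have hpowpos : 0 < (max C₀ 1 * S * (T - t)) ^ N := pow_pos (mul_pos (mul_pos hC₀pos hSpos) hTt) N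
    rw [inv_pow] at h1
    have h3 := (inv_mul_le_iff₀ hpowpos).1 h1
    calc _ ≤ (max C₀ 1 * S * (T - t)) ^ N * (n * (max C' 0 * ((T - t) ^ (k + 2))⁻¹)) := h3
      _ = n * max C' 0 * (max C₀ 1 * S) ^ N * ((T - t) ^ N * ((T - t) ^ (k + 2))⁻¹) := by
          rw [mul_pow]; ring
      _ = n * max C' 0 * (max C₀ 1 * S) ^ N := by
          rw [hN2, mul_inv_cancel₀ (pow_pos hTt _).ne', mul_one]
  rw [← Real.sqrt_sq_eq_abs]
  exact Real.sqrt_le_sqrt h2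

/-! #### The velocity of the scaled metric in the chart -/

/-- **`|G_t(y)(v,w) − 2(T−t) Ric(G_t)(y)(v,w)| ≤ K^{1/2} C₀ (T−t)^{1+δ} |v| |w|`** along a Ricci
flow whose tensor `g − 2(T−t)Ric` has `|g − 2(T−t)Ric|²_g ≤ K (T−t)^{2δ}` and whose representative
has `‖G_t(y)‖ ≤ C₀ (T−t)`: Cauchy–Schwarz for the metric square norm
(`sq_apply_le_normSq_mul`) on the frame vectors `X_v`, `X_w`, with `g(X_v, X_v) = G_t(y)(v,v) ≤
C₀ (T−t)|v|²`, and naturality of the Ricci tensor under the inverse chart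
(`IsRicciFlow.ricAt_chartRep_eq_ricci`). [cite: Hamilton1982, §17, Thm. 17.6] -/
theorem abs_chartRep_sub_two_mul_ricAt_le (hflow : IsRicciFlow g cov (Ico 0 T))
    (hR : ∀ t ∈ Ico 0 T, (g t).IsRiemannian) (ht₀ : t₀ ∈ Ico 0 T) (z : M) {r : ℝ}
    (hcl : closedBall (extChartAt I z z) r ⊆ (extChartAt I z).target) {C₀ : ℝ}
    (hGup : ∀ t ∈ Ico t₀ T, ∀ y ∈ closedBall (extChartAt I z z) r, ‖chartRep I g z t y‖ ≤ C₀ * (T - t))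
    {K δ : ℝ} (hK : 0 ≤ K)
    (hvel : ∀ t ∈ Ico t₀ T, ∀ x : M,
      (g t).normSq x ((g t).toBilinForm x - (2 * (T - t)) • ((cov t).ricci x)) ≤ K * (T - t) ^ (2 * δ)) :
    ∀ t ∈ Ico t₀ T, ∀ y ∈ closedBall (extChartAt I z z) r, ∀ v w : E,
      |chartRep I g z t y v w - 2 * (T - t) * ricAt (chartRep I g z t) y v w| ≤
        Real.sqrt K * C₀ * (T - t) ^ (1 + δ) * ‖v‖ * ‖w‖ := by
  intro t ht y hy v w
  have hTt : 0 < T - t := sub_pos.2 ht.2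
  have ht' : t ∈ Ico 0 T := ⟨ht₀.1.trans ht.1, ht.2⟩
  have hy' : y ∈ (extChartAt I z).target := hcl hy
  -- the frame vectors
  set x : M := (extChartAt I z).symm y with hx
  set Xv : TangentSpace I x := (trivializationAt E (TangentSpace I : M → Type _) z).symmL ℝ x v with hXv
  set Xw : TangentSpace I x := (trivializationAt E (TangentSpace I : M → Type _) z).symmL ℝ x w with hXw
  -- the chart entries are metric values on the frame vectors
  have hGvw : chartRep I g z t y v w = (g t).val x Xv Xw := rfl
  have hGvv : chartRep I g z t y v v = (g t).val x Xv Xv := rfl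
  have hGww : chartRep I g z t y w w = (g t).val x Xw Xw := rfl
  have hRic : ricAt (chartRep I g z t) y v w = (cov t).ricci x Xv Xw :=
    hflow.ricAt_chartRep_eq_ricci ht' z ⟨y, hy'⟩ v w
  -- Cauchy–Schwarz for the tensor `S = g − 2(T−t) Ric`
  have hCS := (g t).sq_apply_le_normSq_mul x (hR t ht')
    ((g t).toBilinForm x - (2 * (T - t)) • ((cov t).ricci x)) Xv Xw
  have hS : ((g t).toBilinForm x - (2 * (T - t)) • ((cov t).ricci x)) Xv Xw =
      chartRep I g z t y v w - 2 * (T - t) * ricAt (chartRep I g z t) y v w := by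
    rw [hRic, hGvw]
    simp [smul_eq_mul]
  rw [hS, ← hGvv, ← hGww] at hCS
  -- `G_t(y)(u, u) ≤ C₀ (T−t) |u|²`
  have hdiag : ∀ u : E, chartRep I g z t y u u ≤ C₀ * (T - t) * ‖u‖ ^ 2 := by
    intro u
    have h1 := abs_apply₂_le (chartRep I g z t y) u u
    have h2 : ‖chartRep I g z t y‖ * ‖u‖ * ‖u‖ ≤ C₀ * (T - t) * ‖u‖ * ‖u‖ := by
      gcongr; exact hGup t ht y hy
    calc chartRep I g z t y u u ≤ C₀ * (T - t) * ‖u‖ * ‖u‖ := (le_abs_self _).trans (h1.trans h2)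
      _ = C₀ * (T - t) * ‖u‖ ^ 2 := by ring
  have hnn : ∀ u : E, 0 ≤ chartRep I g z t y u u := fun u ↦ by
    by_cases hu : u = 0
    · rw [hu]; simp
    · exact (chartRep_pos (hR t ht') z ⟨y, hy'⟩ u hu).le
  have hC₀' : 0 ≤ C₀ * (T - t) := (norm_nonneg _).trans (hGup t ht y hy)
  have hnormSq : 0 ≤ (g t).normSq x ((g t).toBilinForm x - (2 * (T - t)) • ((cov t).ricci x)) :=
    (g t).normSq_nonneg x (hR t ht') _
  -- assemble
  have hsq : (chartRep I g z t y v w - 2 * (T - t) * ricAt (chartRep I g z t) y v w) ^ 2 ≤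
      (Real.sqrt K * C₀ * (T - t) ^ (1 + δ) * ‖v‖ * ‖w‖) ^ 2 := by
    calc _ ≤ (g t).normSq x ((g t).toBilinForm x - (2 * (T - t)) • ((cov t).ricci x)) *
          chartRep I g z t y v v * chartRep I g z t y w w := hCS
      _ ≤ (K * (T - t) ^ (2 * δ)) * (C₀ * (T - t) * ‖v‖ ^ 2) * (C₀ * (T - t) * ‖w‖ ^ 2) := by
          have h1 := hvel t ht x
          exact mul_le_mul (mul_le_mul h1 (hdiag v) (hnn v) (by positivity)) (hdiag w) (hnn w)
            (by positivity)
      _ = (Real.sqrt K * C₀ * (T - t) ^ (1 + δ) * ‖v‖ * ‖w‖) ^ 2 := by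
          have hK' : Real.sqrt K ^ 2 = K := Real.sq_sqrt hK
          have hpow : ((T - t) ^ (1 + δ)) ^ 2 = (T - t) ^ (2 * δ) * (T - t) * (T - t) := by
            rw [← rpow_natCast ((T - t) ^ (1 + δ)) 2, ← rpow_mul hTt.le]
            rw [show (1 + δ) * ((2 : ℕ) : ℝ) = 2 * δ + 1 + 1 by push_cast; ring,
              rpow_add_one hTt.ne', rpow_add_one hTt.ne']
          have hexp : (Real.sqrt K * C₀ * (T - t) ^ (1 + δ) * ‖v‖ * ‖w‖) ^ 2 =
              Real.sqrt K ^ 2 * C₀ ^ 2 * ((T - t) ^ (1 + δ)) ^ 2 * ‖v‖ ^ 2 * ‖w‖ ^ 2 := by ring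
          rw [hexp, hK', hpow]; ring
  have hrhs : 0 ≤ Real.sqrt K * C₀ * (T - t) ^ (1 + δ) * ‖v‖ * ‖w‖ := by
    have hC₀nn : 0 ≤ C₀ := nonneg_of_mul_nonneg_left hC₀' hTt
    positivity
  exact abs_le_of_sq_le_sq' hsq hrhs |>.elim fun h1 h2 ↦ abs_le.2 ⟨h1, h2⟩

/-- **HELPER `helper_scaledChartRep_tendsto`** — the registered form of
`scaledChartRep_tendsto_of_envelope` (convergence of the scaled chart representatives in operator
norm with a rate, from a convergent two-sided logarithmic envelope; Hamilton 1982, Lemma 14.2).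
[cite: Hamilton1982, §14, Lemma 14.2] -/
theorem helper_scaledChartRep_tendsto : ∀ {E : Type u} [NormedAddCommGroup E] [NormedSpace ℝ E] [FiniteDimensional ℝ E] {H : Type v} [TopologicalSpace H] {I : ModelWithCorners ℝ E H} [I.Boundaryless] {M : Type w} [TopologicalSpace M] [ChartedSpace H M] [IsManifold I ∞ M] {g : ℝ → PseudoRiemannianMetric I ∞ E (TangentSpace I : M → Type _)} {T t₀ : ℝ} {a : ℝ → ℝ} (z : M) {r : ℝ}, IsContMDiffFamilyOn ∞ g (Ico 0 T) → (∀ t ∈ Ico 0 T, (g t).IsRiemannian) → t₀ ∈ Ico 0 T → (∀ t ∈ Ico t₀ T, 0 ≤ a t ∧ a t ≤ a t₀) → Tendsto a (𝓝[<] T) (𝓝 0) → 0 ≤ r → Metric.closedBall (extChartAt I z z) r ⊆ (extChartAt I z).target → (∀ y ∈ Metric.closedBall (extChartAt I z z) r, ∀ v : E, ∃ ℓ : ℝ, Tendsto (fun s ↦ chartRep I g z s y v v / (T - s)) (𝓝[<] T) (𝓝 ℓ) ∧ ∀ t ∈ Ico t₀ T, Real.exp (-a t) * (chartRep I g z t y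 v v / (T - t)) ≤ ℓ ∧ ℓ ≤ Real.exp (a t) * (chartRep I g z t y v v / (T - t))) → ∃ lam > (0 : ℝ), ∃ C₀ : ℝ, ∃ L : E → E →L[ℝ] E →L[ℝ] ℝ, ∀ y ∈ Metric.closedBall (extChartAt I z z) r, Tendsto (fun t ↦ (T - t)⁻¹ • chartRep I g z t y) (𝓝[<] T) (𝓝 (L y)) ∧ (∀ v w, L y v w = L y w v) ∧ (∀ v, lam * ‖v‖ ^ 2 ≤ L y v v) ∧ ∀ t ∈ Ico t₀ T, (∀ v, lam * (T - t) * ‖v‖ ^ 2 ≤ chartRep I g z t y v v) ∧ ‖chartRep I g z t y‖ ≤ C₀ * (T - t) ∧ ‖(T - t)⁻¹ • chartRep I g z t y - L y‖ ≤ C₀ * a t := by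
  intro E _ _ _ H _ I _ M _ _ _ g T t₀ a z r hsm hR ht₀ ha ha0 hr hcl henv
  exact scaledChartRep_tendsto_of_envelope hsm hR ht₀ ha ha0 z hr hcl henv

end General


end Summit.SmoothPoincare4.SmoothPoincare4.Theorems.MargerinRails

end
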